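import Literature.Probability.Percolation.SiteCouplingMachine
import Literature.Probability.Percolation.SiteEnhancementProp42
import HarnessLib

/-!
# The `ℋ`-side of the site coupling: the exploration read on the copies of the sites of `ℋ` and on the
# mark coins (Martineau–Severo 2019, §5, Step ∞; site adaptation, Remark 4)

Support file of the inline proof of the site version of Martineau–Severo's Corollary 2.2
(`MartineauSevero2019_cor22_site`, Proposition 4.1); site twin of the tree's `CouplingHSide.lean`. The machine
of `SiteCouplingMachine.lean` is run on the star coins of `CoveringQuotientBlocks.lean` over the coordinates
`V(ℋ) ⊔ V(ℋ)` (`N` copies of every site and `N` mark coins per vertex, all `p̂`-coins): a site query reads the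
`N` copies of its site (open iff some copy is), a bonus reads the `N` mark coins of its vertex (marked iff all
are). We prove that this encoding is good (fresh), that the transcript is consistent with the decoded pair
`(ω, α) = ((∨_k ω_{v,k})_v, (∧_k α_{u,k})_u)`, and hence, by exploration correctness and block aggregation
(`StarCoins.map_blockOf`), that

  `P_{⊤,p̂}(an explored vertex at distance ≥ L at time K) = ℙ_{p,s}(𝓔_L)`, `p = 1-(1-p̂)^N`, `s = p̂^N`,
  `K ≥ haltBound`

(`SiteCoupling.measureReal_reachState_H`), where `ℙ_{p,s}` is `SiteEnhProp42.siteEnhMeasure`.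

## References

* S. Martineau, F. Severo, Ann. Probab. 47 (2019), §5 (Step ∞; Remark 4) [MartineauSevero2019].
-/

noncomputable section

namespace Literature.Probability.Percolation

open MeasureTheory Literature.Barriers.CriticalPhenomena ProbeHistory StarCoins Coupling
open scoped Classical

namespace SiteCoupling

variable {Q : Type*}

/-! ### Coins of a coordinate (generic coordinate type) -/

section Coins

variable {ι : Type*}

/-- The `N` coins of a coordinate `i` of an arbitrary coordinate type. [cite: MartineauSevero2019, §5 (the copies (e, k)); Remark 4 ("each vertex has M possible states")] -/
def coinsOf (N : ℕ) (i : ι) : Finset (Sym2 (Carrier ι N)) :=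
  Finset.univ.image fun k : Fin N => coin i k

/-- Membership in `coinsOf`. [cite: MartineauSevero2019, §5 (the copies (e, k))] -/
theorem mem_coinsOf {N : ℕ} {i : ι} {c : Sym2 (Carrier ι N)} :
    c ∈ coinsOf N i ↔ ∃ k : Fin N, c = coin i k := by
  simp only [coinsOf, Finset.mem_image, Finset.mem_univ, true_and]
  exact ⟨fun ⟨k, hk⟩ => ⟨k, hk.symm⟩, fun ⟨k, hk⟩ => ⟨k, hk.symm⟩⟩

/-- `|coinsOf N i| = N`. [cite: MartineauSevero2019, §5 (the copies (e, k))] -/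
theorem card_coinsOf (N : ℕ) (i : ι) : (coinsOf N i).card = N := by
  rw [coinsOf, Finset.card_image_of_injective _ (fun k k' h => (coin_eq_coin_iff.1 h).2), Finset.card_univ,
    Fintype.card_fin]

/-- Coins of distinct coordinates are disjoint. [cite: MartineauSevero2019, §5 (the copies (e, k))] -/
theorem disjoint_coinsOf {N : ℕ} {i j : ι} (h : i ≠ j) : Disjoint (coinsOf N i) (coinsOf N j) := by
  rw [Finset.disjoint_left]
  intro c hc hc'
  obtain ⟨k, rfl⟩ := mem_coinsOf.1 hc
  obtain ⟨k', hk'⟩ := mem_coinsOf.1 hc'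
  exact h (coin_eq_coin_iff.1 hk').1

/-- Coins are edges of the complete coin graph. [cite: MartineauSevero2019, §5 (the multigraph)] -/
theorem coinsOf_subset_edgeSet (N : ℕ) (i : ι) :
    (↑(coinsOf N i) : Set (Sym2 (Carrier ι N))) ⊆ (⊤ : SimpleGraph (Carrier ι N)).edgeSet := by
  intro c hc
  obtain ⟨k, rfl⟩ := mem_coinsOf.1 hc
  exact coin_mem_edgeSet _ _

/-- Some coin of a coordinate is observed open iff some copy is open. [cite: MartineauSevero2019, §5 ("∨_k ω_{e,k}")] -/
theorem obs_coinsOf_nonempty_iff {N : ℕ} {ω : Set (Sym2 (Carrier ι N))} {i : ι} :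
    (obs ω (coinsOf N i)).Nonempty ↔ ∃ k : Fin N, coin i k ∈ ω := by
  constructor
  · rintro ⟨c, hc⟩
    rw [mem_obs_iff] at hc
    obtain ⟨k, rfl⟩ := mem_coinsOf.1 hc.1
    exact ⟨k, hc.2⟩
  · rintro ⟨k, hk⟩
    exact ⟨coin i k, mem_obs_iff.2 ⟨mem_coinsOf.2 ⟨k, rfl⟩, hk⟩⟩

/-- All coins of a coordinate are observed open iff all copies are open. [cite: MartineauSevero2019, §5 (α_u)] -/
theorem obs_coinsOf_eq_iff {N : ℕ} {ω : Set (Sym2 (Carrier ι N))} {i : ι} :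
    obs ω (coinsOf N i) = coinsOf N i ↔ ∀ k : Fin N, coin i k ∈ ω := by
  constructor
  · intro h k
    have : coin i k ∈ obs ω (coinsOf N i) := by rw [h]; exact mem_coinsOf.2 ⟨k, rfl⟩
    exact (mem_obs_iff.1 this).2
  · intro h
    ext c
    rw [mem_obs_iff]
    constructor
    · exact fun hc => hc.1
    · intro hc
      obtain ⟨k, rfl⟩ := mem_coinsOf.1 hc
      exact ⟨hc, h k⟩

end Coins

/-! ### The encoding on star coins -/

/-- The coin type of the `ℋ`-side: `N` copies of every coordinate of `V(ℋ) ⊔ V(ℋ)` (sites and marks).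
[cite: MartineauSevero2019, §5 Remark 4 ("each vertex has M possible states")] -/
abbrev CoinH (Q : Type*) (N : ℕ) : Type _ := Carrier (Q ⊕ Q) N

/-- **The `ℋ`-side encoding**: a site query reads the `N` copies of the site, a bonus reads the `N` mark coins
of the vertex. [cite: MartineauSevero2019, §5 (Step 2K+1 on ℋ̂; s-exploration on ℋ); Remark 4] -/
def encH (N : ℕ) : List Bool → Query Q → Finset (Sym2 (CoinH Q N))
  | _, Query.edge _ b => coinsOf N (Sum.inl b)
  | _, Query.bonus u => coinsOf N (Sum.inr u)

variable (H : SimpleGraph Q) [H.LocallyFinite] (o : Q) (r L N : ℕ)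

/-- The coins used along a transcript: the copies of the queried sites and the mark coins of the attempted
vertices. [cite: MartineauSevero2019, §5 (the p-explored and s-explored objects)] -/
def usedH (b : List Bool) : Finset (Sym2 (CoinH Q N)) :=
  (stateOf H o r L N b).Qd.biUnion (fun v => coinsOf N (Sum.inl v)) ∪
    (stateOf H o r L N b).Y.biUnion (fun u => coinsOf N (Sum.inr u))

variable {H o r L N}

/-- Membership in `usedH`. [cite: MartineauSevero2019, §5 (the p-explored and s-explored objects)] -/
theorem mem_usedH {b : List Bool} {c : Sym2 (CoinH Q N)} :
    c ∈ usedH H o r L N b ↔ (∃ v ∈ (stateOf H o r L N b).Qd, c ∈ coinsOf N (Sum.inl v)) ∨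
      (∃ u ∈ (stateOf H o r L N b).Y, c ∈ coinsOf N (Sum.inr u)) := by
  simp [usedH]

/-- **The `ℋ`-side encoding is good** (fresh: a site is queried at most once and a bonus attempted at most
once, so their coins were never read). [cite: MartineauSevero2019, §5 ("No vertex or edge will get explored more than once")] -/
theorem goodEnc_H : TExplore.GoodEnc (machine H o r L N) (encH N) (⊤ : SimpleGraph (CoinH Q N)) := by
  refine TExplore.goodEnc_of_used (usedH H o r L N) ?_ ?_ ?_ ?_
  · intro b q _
    cases q with
    | edge a c => exact coinsOf_subset_edgeSet N _
    | bonus u => exact coinsOf_subset_edgeSet N _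
  · intro b q _
    cases q with
    | edge a c => exact card_coinsOf N _
    | bonus u => exact card_coinsOf N _
  · intro b q ans hq
    have hq' : nq H o r L (stateOf H o r L N b) = some q := hq
    have h1 : encH N b q ⊆ usedH H o r L N (ans :: b) := by
      intro c hc
      rw [mem_usedH, stateOf_cons_of_some hq']
      cases q with
      | edge a d =>
        exact Or.inl ⟨d, mem_Qd_hstep_edge.2 (Or.inl rfl), hc⟩
      | bonus u =>
        exact Or.inr ⟨u, mem_Y_hstep_bonus.2 (Or.inl rfl), hc⟩
    have h2 : usedH H o r L N b ⊆ usedH H o r L N (ans :: b) := by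
      intro c hc
      obtain ⟨mA, mQd, mO, mY, -⟩ := mono_cons (H := H) (o := o) (r := r) (L := L) (N := N) ans b
      rw [mem_usedH]
      rcases mem_usedH.1 hc with ⟨v, hv, hcv⟩ | ⟨u, hu, hcu⟩
      · exact Or.inl ⟨v, mQd hv, hcv⟩
      · exact Or.inr ⟨u, mY hu, hcu⟩
    convert Finset.union_subset h1 h2 using 3
  · intro b q hq
    have hq' : nq H o r L (stateOf H o r L N b) = some q := hq
    rw [Finset.disjoint_left]
    intro c hc hcu
    rcases mem_usedH.1 hcu with ⟨v, hv, hcv⟩ | ⟨u, hu, hcu⟩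
    · cases q with
      | edge a d =>
        obtain ⟨-, -, -, hQ⟩ := nq_edge_spec hq'
        have hne : (Sum.inl d : Q ⊕ Q) ≠ Sum.inl v := fun h => hQ (by cases h; exact hv)
        exact Finset.disjoint_left.1 (disjoint_coinsOf hne) hc hcv
      | bonus u' =>
        exact Finset.disjoint_left.1 (disjoint_coinsOf (Sum.inr_ne_inl : (Sum.inr u' : Q ⊕ Q) ≠ Sum.inl v)) hc hcv
    · cases q with
      | edge a d =>
        exact Finset.disjoint_left.1 (disjoint_coinsOf (Sum.inl_ne_inr : (Sum.inl d : Q ⊕ Q) ≠ Sum.inr u)) hc hcu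
      | bonus u' =>
        obtain ⟨-, -, -, hY, -⟩ := nq_bonus_spec hq'
        have hne : (Sum.inr u' : Q ⊕ Q) ≠ Sum.inr u := fun h => hY (by cases h; exact hu)
        exact Finset.disjoint_left.1 (disjoint_coinsOf hne) hc hcu

/-! ### Decoding and consistency -/

variable (N) in
/-- The `ℋ`-side aggregator: a site is open iff some copy is open; a vertex is marked iff all its mark coins
are open. [cite: MartineauSevero2019, §5 ("(∨_k ω_{e,k})_e", "α"); Remark 4] -/
def aggH : Q ⊕ Q → (Fin N → Prop) → Prop
  | Sum.inl _, h => ∃ k, h k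
  | Sum.inr _, h => ∀ k, h k

variable (N) in
/-- The decoded joint configuration `(ω, α)` of a coin configuration. [cite: MartineauSevero2019, §5 (Step ∞)] -/
def decodeH (ω : Set (Sym2 (CoinH Q N))) : Set (Q ⊕ Q) := blockOf (aggH (Q := Q) N) ω

/-- Decoded sites: some copy open. [cite: MartineauSevero2019, §5 ("∨_k ω_{e,k}")] -/
theorem mem_enhSiteOmega_decodeH {ω : Set (Sym2 (CoinH Q N))} {v : Q} :
    v ∈ enhSiteOmega (decodeH N ω) ↔ ∃ k : Fin N, coin (Sum.inl v : Q ⊕ Q) k ∈ ω := by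
  rw [mem_enhSiteOmega, decodeH, mem_blockOf, aggH]

/-- Decoded marks: all mark coins open. [cite: MartineauSevero2019, §5 (α)] -/
theorem mem_enhSiteAlpha_decodeH {ω : Set (Sym2 (CoinH Q N))} {u : Q} :
    u ∈ enhSiteAlpha (decodeH N ω) ↔ ∀ k : Fin N, coin (Sum.inr u : Q ⊕ Q) k ∈ ω := by
  rw [mem_enhSiteAlpha, decodeH, mem_blockOf, aggH]

/-- The encoding of a site query. [cite: MartineauSevero2019, §5 (Step 2K+1)] -/
theorem encH_edge {b : List Bool} {a c : Q} : encH N b (Query.edge a c) = coinsOf N (Sum.inl c) := rfl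

/-- The encoding of a bonus query. [cite: MartineauSevero2019, §5 (Step 2K+2)] -/
theorem encH_bonus {b : List Bool} {u : Q} : encH N b (Query.bonus u) = coinsOf N (Sum.inr u) := rfl

/-- The recorded answer to a site query: some probed coin open. [cite: MartineauSevero2019, §5 (Step 2K+1)] -/
theorem answer_edge_eq_true_iff {a c : Q} {D : Finset (Sym2 (CoinH Q N))} {ω : Set (Sym2 (CoinH Q N))} :
    TExplore.answer (machine H o r L N) (Query.edge a c) (D, obs ω D) = true ↔ (obs ω D).Nonempty := by
  simp [TExplore.answer, machine]

/-- The recorded answer to a bonus query: all probed coins open. [cite: MartineauSevero2019, §5 (Step 2K+2)] -/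
theorem answer_bonus_eq_true_iff {u : Q} {D : Finset (Sym2 (CoinH Q N))} {ω : Set (Sym2 (CoinH Q N))} :
    TExplore.answer (machine H o r L N) (Query.bonus u) (D, obs ω D) = true ↔ obs ω D = D := by
  simp [TExplore.answer, machine]

/-- **The transcript is consistent with the decoded pair** `((∨_k ω_{v,k})_v, (∧_k α_{u,k})_u)` along every
run of the `ℋ`-side. [cite: MartineauSevero2019, §5 (Step ∞)] -/
theorem consistent_bt_H (ω : Set (Sym2 (CoinH Q N))) (k : ℕ) :
    Consistent (H := H) (o := o) (r := r) (L := L) (N := N) (enhSiteOmega (decodeH N ω)) (enhSiteAlpha (decodeH N ω))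
      (TExplore.bt (machine H o r L N) ((TExplore.texpl (machine H o r L N) (encH N)).hist k ω)) := by
  induction k with
  | zero => simp [Consistent]
  | succ k ih =>
    cases hq : nq H o r L (stateOf H o r L N (TExplore.bt (machine H o r L N)
        ((TExplore.texpl (machine H o r L N) (encH N)).hist k ω))) with
    | none =>
      rw [TExplore.bt_hist_succ_of_none goodEnc_H hq]
      exact ih
    | some q =>
      rw [TExplore.bt_hist_succ_of_some goodEnc_H hq]
      refine ⟨ih, ?_⟩
      rw [hq]
      cases q with
      | edge a c =>
        simp only
        rw [encH_edge, answer_edge_eq_true_iff, obs_coinsOf_nonempty_iff, mem_enhSiteOmega_decodeH]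
      | bonus u =>
        simp only
        rw [encH_bonus, answer_bonus_eq_true_iff, obs_coinsOf_eq_iff, mem_enhSiteAlpha_decodeH]

/-! ### The law: `P_{⊤,p̂}(reach) = ℙ_{p,s}(𝓔_L)` -/

/-- The block probabilities of the `ℋ`-side aggregator are the parameters `(1-(1-p̂)^N on sites, p̂^N on
marks)`. [cite: MartineauSevero2019, §5 (p̂; s)] -/
theorem blockMeasure_aggH (ph : unitInterval) (i : Q ⊕ Q) :
    blockMeasure ph N {h | aggH (Q := Q) N i h} =
      unitInterval.toNNReal (SiteEnhProp42.siteEnhParams (Q := Q) (orParam ph N) (andParam ph N) i) := by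
  cases i with
  | inl v =>
    have : {h : Fin N → Prop | aggH (Q := Q) N (Sum.inl v) h} = {h | ∃ k, h k} := by
      ext h; simp [aggH]
    rw [this, blockMeasure_exists]
    simp [SiteEnhProp42.siteEnhParams]
  | inr u =>
    have : {h : Fin N → Prop | aggH (Q := Q) N (Sum.inr u) h} = {h | ∀ k, h k} := by
      ext h; simp [aggH]
    rw [this, blockMeasure_forall]
    simp [SiteEnhProp42.siteEnhParams]

/-- **The decoded configuration is `ℙ_{p,s}`-distributed**, `p = 1-(1-p̂)^N`, `s = p̂^N`.
[cite: MartineauSevero2019, §5 (Step ∞: "which has distribution Ber(p)^{⊗E(ℋ)} ⊗ Ber(s)^{⊗V(ℋ)}"); Remark 4] -/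
theorem map_decodeH (ph : unitInterval) :
    (bondPercolation (⊤ : SimpleGraph (CoinH Q N)) ph).map (decodeH (Q := Q) N) =
      SiteEnhProp42.siteEnhMeasure Q (orParam ph N) (andParam ph N) := by
  rw [SiteEnhProp42.siteEnhMeasure]
  exact map_blockOf ph (aggH (Q := Q) N) _ (blockMeasure_aggH ph)

/-- **The `ℋ`-side law**: for `K ≥ haltBound`, the probability that the exploration read on the site coins of
`ℋ̂` has explored a vertex at distance `≥ L` equals `ℙ_{p,s}(𝓔_L)`.
[cite: MartineauSevero2019, §5 (Step ∞) and Proposition 4.1] -/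
theorem measureReal_reachState_H [Countable Q] (hH : H.Connected) (ph : unitInterval) {K : ℕ}
    (hK : haltBound H o r L ≤ K) :
    (bondPercolation (⊤ : SimpleGraph (CoinH Q N)) ph).real
        {ω | ReachState H o L (stateOf H o r L N (TExplore.bt (machine H o r L N)
          ((TExplore.texpl (machine H o r L N) (encH N)).hist K ω)))} =
      (SiteEnhProp42.siteEnhMeasure Q (orParam ph N) (andParam ph N)).real (enhSiteEvent H r o L) := by
  have hset : {ω : Set (Sym2 (CoinH Q N)) | ReachState H o L (stateOf H o r L N (TExplore.bt (machine H o r L N)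
      ((TExplore.texpl (machine H o r L N) (encH N)).hist K ω)))} = decodeH N ⁻¹' enhSiteEvent H r o L := by
    ext ω
    rw [Set.mem_setOf_eq, Set.mem_preimage, mem_enhSiteEvent_iff]
    exact reachState_iff_of_halted hH (consistent_bt_H ω K) (nq_stateOf_bt_eq_none hH goodEnc_H hK ω)
  have hmeas : Measurable (decodeH (Q := Q) N) := measurable_blockOf _
  rw [hset, ← map_measureReal_apply hmeas (determinedBy_enhSiteEvent_enhSiteWindow hH r o L).measurableSet_of_finset,
    map_decodeH]

end SiteCoupling

end Literature.Probability.Percolation
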